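import Literature.MathematicalPhysics.QuantumFieldTheory.Balaban1983to89.B8Prop6Reg335ZdAllTorus
import Literature.MathematicalPhysics.QuantumFieldTheory.Balaban1983to89.Node00.TorusCoverPropSixGauge10
import HarnessLib

/-!
# Route `UnitScaleTilt`, crux «MinimiserStabilityRegPr» (stmt-QuantumFields-19200, EX) ∕ deciding crux 20520 — item I-07 of `pub/ym-inputs/INPUT-LIST.md` (the CLASS-TRANSFER
# row «𝔘_k(α₀) ⊂ (3.35) ∧ (3.36)», [Balaban1985RegularSpaces] Prop. 6): **THE `ℤᵈ` HALF — (3.35) AND (3.36) ON ONE CLASS CUBE OF [4] p. 396 FROM PROPOSITION 6 AS PRINTED**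

Cell `ym-inputs` (desk ym-inputs-plan-1, seat ym-inputs-p06), HUMAN RULING D-0037: YM₃ on T³ is ladder rung R3 — NOT the Clay problem.  Count-neutral helper
(`--supports stmt-QuantumFields-20520 --as helper`); THEOREMS ONLY (0 `def`, 0 `sorry`, 0 `instance`); nothing of [Balaban1985RegularSpaces] ∕
[Balaban1985BackgroundPropagators] is asserted — Proposition 6 is CONSUMED BY NAME (`B8Prop6PrintedZdCubPGamma.prop6Printed_zdCubP_γ_holds`, pub-ymgap N05 lineage).

WHY.  The T³ row `Prop7SectET3BgClass.ClassTransferT3` (the `hCT` binder of the EX knit's `norm_G` ∕ `norm_H₁` rows) reads BOTH (3.35) and (3.36) of [4] =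
[Balaban1985BackgroundPropagators] at the V1 cube class of the member.  The N05 lineage's bridge `B8Prop6Reg335Cube.reg335Cube_of_gaugedBoundB8` and its assembly
`B8Prop6Reg335ZdAllTorus` produce (3.35) only (their HONEST SCOPE: «(3.36) is not produced — no binder reads `Reg336`»).  HERE: the same bridge WITH print's
second-order member (1.136)₃ «(Lʲη)³|∂^{η*}∂^ηA| ≤ 7dL²B₁Mα₀» (the ninth conjunct of `Node00.GaugedBoundB8`, read pointwise by dag-n07-e's
`Node00.TorusCoverPropSixGauge10`) turned into r06's (3.36) letter `divPη ∘ curlη` at the flat background, and the one-cube assembly on `ℤᵈ` with every `Ω_j = ℤᵈ`.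

WHAT IS PROVED (kernel-checked).
* §0 `mem_cube_top_of_near` — the collar of `□` inside `□_k` has width `ρLᵏ ≥ 1`: every site within sup-distance 1 of `□` lies in `□_k` (the ±1 stencil of (3.36)).
* §1 `divPη_curlη_one_eq_pdiv_plaqCovDeriv` — THE FLAT LETTER IDENTITY: r06's `∂^{η*}∂^η` (`B9Eq39Adjoint.divPη ∘ curlη` for the shifts `shiftT d`, background `1`, bond
  letters `byDir A`) IS n05-a's `B8Eq143PlaqExpansion.pdiv η 1 (B8Eq146AExpansion.plaqCovDeriv η 1 A)` — both are `η⁻²Σ_ν` of the same second differences ((3.4), (3.9) of [4]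
  = (1.1)–(1.2) of [B8] at `U₀ = 1`).
* §2 ★ `reg336Cube_of_gaugedBoundB8` — for `d ≥ 2`, `L ≥ 2`, `η > 0`, a print cube `c : Node00.CubeB8 d L K Ω`, `GaugedBoundB8 L η U₀ c r` (`0 ≤ r < C`) and `Q ⊆ □ = box L c.a c.M c.k`:
  `Reg336Cube (shiftT d) (byDir U₀) η Q (Lᵏη) C` — gauge `u = (v⁻¹u′)⁻¹` (unit type), field `A = (1∕iη) log U₁`, the four (3.35) clauses as in n05-e's §1 and the (3.36) clause
  from (1.136)₃ (`norm_codiff_mlogCfg_le` on `□_k`, unmasked on the stencil by `mlogCfg_of_sideTouches`, §0, §1).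
* §3 ★★ `reg336Cube_zd_of_inAk` — for `d = 3`, odd `L ≥ 5`, `𝔸` a nontrivial C⋆-algebra: `∃ c35 c₆ > 0, ∀ η > 0, ∀ k ≥ 1, ∀ M ≥ 1, ∀ Q, IsCube396Zd M L k Q →
  ∀ U₀ unitary, ∀ α₀ > 0, M·α₀ ≤ c₆ → InAk L k η α₀ (Ω ≡ ℤ³) U₀ → ∀ c ≥ c35, Reg336Cube (shiftT 3) (byDir U₀) η Q (Lᵏη) (c·M·α₀)` — the one-cube twin of n05-e's
  `prop6At_bgZd_allTorus_of_prop6Printed` (inscription `exists_printCube_over_classCube` into a print cube of the all-torus datum `torusIdx ⟨η, k⟩`, Proposition 6 by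
  `prop6Printed_zdCubP_γ_holds`, threshold `7dL²·c.M·α₀ ≤ c₁` from `M·α₀ ≤ c₆`, §2), constants `c35 = 1134·L³·B₁·ρ₀ + 253`, `c₆ = min (1∕126) (c₁∕(1134·L³·ρ₀))` as there
  (`B₁ = 15LB₀`; `ρ₀, B₀, c₁` print's constants of the γ-line), MONOTONE in the constant (stated `∀ c ≥ c35`).
HONEST SCOPE.  Bookkeeping over landed objects; the `ℤᵈ` member is the ALL-TORUS one (every `Ω_j = ℤᵈ` — the pure-small-field problem of R3; general law members are
n05-e's `B8Prop6Reg335ZdLawMember`, not needed here); the T³ descent is the companion `…Prop7SectET3ClassTransfer`.  One finite lattice programme at fixed spacing; NOT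
continuum ∕ OS ∕ mass gap ∕ Clay; N05 ∕ N06 NOT discharged by this file.

References: T. Bałaban, CMP **99** (1985) 75–102 [Balaban1985RegularSpaces] ((1.1)–(1.2) p.76, (1.33) p.82, p.98, Prop. 6 (1.135)–(1.138) p.99); CMP **99** (1985)
389–434 [Balaban1985BackgroundPropagators] ((3.4) p.391, (3.9) p.392, (3.35)–(3.36) p.396).
-/

noncomputable section

open NormedSpace
open Complex (I)

namespace Summit.QuantumFields.YangMills.Theorems.Prop7SectET3ClassTransferZd

open Literature.MathematicalPhysics.QuantumFieldTheory.Balaban1983to89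
open B7Prop1Explicit B7Prop2Explicit B7Prop1Local
open B7Eq78Linearization (conjR)
open B8Ineq130 (tlo thi)
open B8Ineq132 (InAk covDerivFwd covDeriv BondTouches)
open B8Eq131Cubes (box cube tcube bLo bHi tLo tHi cube_eq margin_top box_subset_cube_top cube_subset_tcube)
open B8Eq131CubesAdmissible (cubeFam cubeFam_false_of_le)
open B8Eq140Level (SideTouches sideTouches_of_bondTouches)
open B8Eq138LandauZd (logCfg)
open B8Eq184Proof (cfgExp)
open B8LeafModelZd (ZdIdx)
open B8LeafModelZd3 (mlogCfg mlogCfg_of_sideTouches)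
open B8ScaledSupNorm (msup Bdd weight norm_le_of_msup_le bondNorm)
open B8Eq146AExpansion (plaqCovDeriv)
open B8Eq143PlaqExpansion (pdiv)
open B8Eq133Hypotheses (shiftT byDir byDir_apply shiftT_apply gaugeTr_byDir)
open B9Eq39Adjoint (R covD covDstar curl curlη divP divPη fluct)
open B9Eq3117Current (gaugeTr)
open B9Eq335RegularityClasses (Reg335Cube Reg336Cube)
open LatticeNorms (scaleLen)
open B8Thm2TorusMember (TorusMember torusIdx)
open B9SupplySockB9P3ZdFrame (IsCube396Zd boxZd bigSideZd)
open B8Prop6Reg335Cube (add_e_mem_cube_top bdd_sideTouches_cubeFam)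
open B8Prop6Reg335ZdAllTorus (exists_printCube_over_classCube)
open B8Prop6PrintedZdCubPGamma (prop6Printed_zdCubP_γ_holds)
open Node00 (CubeB8 GaugedBoundB8 zdCubP prop6Printed_zdCubP_iff norm_codiff_mlogCfg_le pdiv_plaqCovDeriv_one_congr covDeriv_one_apply
  plaqCovDeriv_one_apply)

variable {d : ℕ}

/-! ## §0 The collar of `□` inside `□_k` hosts the ±1 stencil -/

/-- **A site within sup-distance `1` of `□ = [Lᵏa, Lᵏ(a + M) − 1]ᵈ` lies in `□_k`** (the collar «R₁M₁Lᵏη» of p. 98 has width `ρLᵏ ≥ 1` fine sites).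
[cite: Balaban1985RegularSpaces, p.98 («□_j ⊃ □_{j+1} and a distance between boundaries of these cubes is equal to R₁M₁Lʲη»)] -/
theorem mem_cube_top_of_near {L : ℕ} (hL : 1 ≤ L) {a : B7Prop1Explicit.Site d} {M ρ k : ℕ} (hρ : 1 ≤ ρ) {z w : B7Prop1Explicit.Site d}
    (hz : z ∈ box L a M k) (hw : ∀ i, z i - 1 ≤ w i ∧ w i ≤ z i + 1) : w ∈ cube L a M ρ k k := by
  rw [cube_eq le_rfl, margin_top]
  have hm : (1 : ℤ) ≤ ((ρ * L ^ k : ℕ) : ℤ) := by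
    have h1 : 1 ≤ ρ * L ^ k := Nat.one_le_iff_ne_zero.mpr (Nat.mul_ne_zero (by omega) (pow_ne_zero _ (by omega)))
    exact_mod_cast h1
  have hz' : InBox (bLo L a k 0) (bHi L a M k 0) z := hz
  intro i
  obtain ⟨h1, h2⟩ := hz' i
  obtain ⟨h3, h4⟩ := hw i
  simp only [bLo, bHi, Nat.cast_zero, sub_zero, add_zero] at h1 h2
  simp only [bLo, bHi]
  constructor <;> linarith

/-- The stencil sites of (3.36) at a bond based in `□`: `x`, `x + e_μ`, `x − e_ν`, `x − e_ν + e_μ` lie in `□_k`. [cite: Balaban1985RegularSpaces, p.98 (bookkeeping)] -/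
theorem stencil_mem_cube_top {L : ℕ} (hL : 1 ≤ L) {a : B7Prop1Explicit.Site d} {M ρ k : ℕ} (hρ : 1 ≤ ρ) {z : B7Prop1Explicit.Site d}
    (hz : z ∈ box L a M k) (μ ν : Fin d) :
    z ∈ cube L a M ρ k k ∧ z + e μ ∈ cube L a M ρ k k ∧ z - e ν ∈ cube L a M ρ k k ∧ z - e ν + e μ ∈ cube L a M ρ k k := by
  have hei : ∀ (κ : Fin d) (i : Fin d), (e κ : B7Prop1Explicit.Site d) i = if i = κ then 1 else 0 := fun κ i => by
    simp only [e, Pi.single_apply]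
  refine ⟨mem_cube_top_of_near hL hρ hz fun i => ⟨by linarith, by linarith⟩, mem_cube_top_of_near hL hρ hz fun i => ?_,
    mem_cube_top_of_near hL hρ hz fun i => ?_, mem_cube_top_of_near hL hρ hz fun i => ?_⟩
  · simp only [Pi.add_apply, hei]; split_ifs <;> constructor <;> linarith
  · simp only [Pi.sub_apply, hei]; split_ifs <;> constructor <;> linarith
  · simp only [Pi.add_apply, Pi.sub_apply, hei]; split_ifs <;> constructor <;> linarith

/-! ## §1 The flat letter identity: r06's `∂^{η*}∂^η` IS n05-a's `pdiv ∘ plaqCovDeriv` at the trivial background -/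

section Flat

variable {𝔸 : Type*} [NormedRing 𝔸] [NormedAlgebra ℂ 𝔸]

/-- `T_ν⁻¹ x = x − e_ν` for the `ℤᵈ` shifts. [cite: Balaban1985BackgroundPropagators, (3.3) p.390 (bookkeeping)] -/
theorem shiftT_symm_apply (ν : Fin d) (x : B7Prop1Explicit.Site d) : (shiftT d ν).symm x = x - e ν := by
  apply (shiftT d ν).injective
  rw [Equiv.apply_symm_apply, shiftT_apply, sub_add_cancel]

/-- r06's flat `η`-curl of the bond letters `byDir A` IS n05-a's `plaqCovDeriv η 1 A` ((3.4) of [4] at `U₀ = 1`).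
[cite: Balaban1985BackgroundPropagators, (3.4) p.391; Balaban1985RegularSpaces, (1.1) p.76] -/
theorem curlη_one_byDir_eq_plaqCovDeriv (η : ℝ) (A : B7Prop1Explicit.Site d → Fin d → 𝔸) (μ ν : Fin d) (x : B7Prop1Explicit.Site d) :
    curlη (shiftT d) (fun _ _ => (1 : 𝔸ˣ)) η (byDir A) μ ν x = plaqCovDeriv η (1 : B7Prop1Explicit.Site d → Fin d → 𝔸ˣ) A μ ν x := by
  rw [plaqCovDeriv_one_apply, ← smul_sub, ← Complex.coe_smul, Complex.ofReal_inv]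
  simp only [curlη, curl, covD, R, byDir_apply, shiftT_apply, Units.val_one, inv_one, one_mul, mul_one]

/-- ★ **THE FLAT LETTER IDENTITY**: r06's `(∂^{η*}∂^ηA)_μ(x)` = `divPη (shiftT d) 1 η (curlη (shiftT d) 1 η (byDir A)) μ x` IS n05-a's
`pdiv η 1 (plaqCovDeriv η 1 A) μ x` ((3.9) ∘ (3.4) of [4] = (1.2) ∘ (1.1) of [B8], trivial background).
[cite: Balaban1985BackgroundPropagators, (3.4) p.391, (3.9) p.392; Balaban1985RegularSpaces, (1.1)–(1.2) p.76] -/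
theorem divPη_curlη_one_eq_pdiv_plaqCovDeriv (η : ℝ) (A : B7Prop1Explicit.Site d → Fin d → 𝔸) (μ : Fin d) (x : B7Prop1Explicit.Site d) :
    divPη (shiftT d) (fun _ _ => (1 : 𝔸ˣ)) η (curlη (shiftT d) (fun _ _ => (1 : 𝔸ˣ)) η (byDir A)) μ x =
      pdiv η (1 : B7Prop1Explicit.Site d → Fin d → 𝔸ˣ) (plaqCovDeriv η 1 A) μ x := by
  classical
  -- the inner letters agree as functions
  have hF : curlη (shiftT d) (fun _ _ => (1 : 𝔸ˣ)) η (byDir A) = plaqCovDeriv η (1 : B7Prop1Explicit.Site d → Fin d → 𝔸ˣ) A := by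
    funext a b y; exact curlη_one_byDir_eq_plaqCovDeriv η A a b y
  rw [hF]
  set F := plaqCovDeriv η (1 : B7Prop1Explicit.Site d → Fin d → 𝔸ˣ) A with hFdef
  -- the flat backward derivatives agree term by term
  have hterm : ∀ (ν : Fin d) (G : B7Prop1Explicit.Site d → 𝔸),
      ((η : ℂ)⁻¹) • covDstar (shiftT d) (fun _ _ => (1 : 𝔸ˣ)) ν G x = covDeriv η (1 : B7Prop1Explicit.Site d → Fin d → 𝔸ˣ) ν G x := by
    intro ν G
    rw [covDeriv_one_apply, ← Complex.coe_smul, Complex.ofReal_inv]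
    simp only [covDstar, R, shiftT_symm_apply, Units.val_one, inv_one, one_mul, mul_one]
  unfold divPη divP pdiv
  rw [smul_sub, Finset.smul_sum, Finset.smul_sum]
  congr 1
  · rw [← Finset.filter_gt_eq_Iio, Finset.sum_filter]
    refine Finset.sum_congr rfl fun ν _ => ?_
    split_ifs with h
    · exact hterm ν (F ν μ)
    · rw [smul_zero]
  · rw [← Finset.filter_lt_eq_Ioi, Finset.sum_filter]
    refine Finset.sum_congr rfl fun ν _ => ?_
    split_ifs with h
    · exact hterm ν (F μ ν)
    · rw [smul_zero]

end Flat

/-! ## §2 The bridge with the third letter: Proposition 6's (1.135)–(1.136) at a print cube ⟹ (3.35)–(3.36) on `□` at scale `Lᵏη` -/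

section Bridge

variable {𝔸 : Type*} [CStarAlgebra 𝔸] [Nontrivial 𝔸]

/-- ★ **PROPOSITION 6's CONCLUSION AT A CUBE IS (3.35)–(3.36) ON `□` AT ITS SCALE**: for `d ≥ 2`, `L ≥ 2`, `η > 0`, a cube `c` of NODE 00's carrier,
`GaugedBoundB8 L η U₀ c r` ((1.135)–(1.138) with the number `0 ≤ r`) and `Q ⊆ □ = box L c.a c.M c.k`: r06's class `Reg336Cube (shiftT d) (byDir U₀) η Q (Lᵏη) C`
for every `C > r` — gauge `u = (v⁻¹u′)⁻¹` (unit type), field `A = (1∕iη) log U₁`, `U₀^u = e^{iηA}`, `|A| < C(Lᵏη)⁻¹`, `|∇^ηA| < C(Lᵏη)⁻²` (n05-e's four clauses,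
re-derived for the SAME `(u, A)`) and «|∂^{η*}∂^ηA| < C(Lᵏη)⁻³ on □» from (1.136)₃ (the masked second-order member read pointwise on `□` by dag-n07-e's
`norm_codiff_mlogCfg_le`, unmasked on the ±1 stencil inside `□_k`, §0, and translated to r06's letters by §1).
[cite: Balaban1985RegularSpaces, Prop. 6 (1.135)–(1.136) p.99, p.98; Balaban1985BackgroundPropagators, (3.35)–(3.36) p.396, (3.28) p.395] -/
theorem reg336Cube_of_gaugedBoundB8 (hd2 : 2 ≤ d) {L K : ℕ} (hL : 2 ≤ L) {Ω : ℕ → Set (B7Prop1Explicit.Site d)} {η : ℝ} (hη : 0 < η)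
    {U₀ : B7Prop1Explicit.Site d → Fin d → 𝔸ˣ} (c : CubeB8 d L K Ω) {r C : ℝ} (hr : 0 ≤ r) (hrC : r < C)
    (h : GaugedBoundB8 L η U₀ c r) {Q : Set (B7Prop1Explicit.Site d)} (hQ : Q ⊆ box L c.a c.M c.k) :
    Reg336Cube (shiftT d) (byDir U₀) η Q (scaleLen (L : ℝ) η c.k) C := by
  classical
  obtain ⟨u, -, -, -, -, h162, hw, h135, h136₂, h136₃, -, -⟩ := h
  have hL1 : 1 ≤ L := le_trans one_le_two hL
  have hρ : 1 ≤ c.ρ := le_trans hL1 c.L_le_ρ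
  have hk : c.sq c.k = cube L c.a c.M c.ρ c.k c.k := cubeFam_false_of_le L c.a c.M c.ρ le_rfl
  -- two distinct directions (`d ≥ 2`), to name a plaquette through a bond
  have hdir : ∀ κ : Fin d, ∃ τ : Fin d, τ ≠ κ := fun κ => by
    by_cases h0 : (κ : ℕ) = 0
    · exact ⟨⟨1, by omega⟩, fun h => by have := congrArg Fin.val h; simp [h0] at this⟩
    · exact ⟨⟨0, by omega⟩, fun h => h0 (by have := congrArg Fin.val h; simpa using this.symm)⟩
  -- geometry: the stencils of the sites of `Q` lie in `□_k ⊆ □̃`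
  have hsideOf : ∀ y, y ∈ cube L c.a c.M c.ρ c.k c.k → ∀ ν : Fin d, SideTouches (c.sq c.k) y ν := fun y hy ν => by
    obtain ⟨τ, hτ⟩ := hdir ν
    rw [hk]
    exact sideTouches_of_bondTouches hτ (Or.inl hy)
  have hmemk : ∀ z ∈ Q, z ∈ cube L c.a c.M c.ρ c.k c.k := fun z hz => box_subset_cube_top L c.a c.M c.ρ c.k (hQ hz)
  have hmemk' : ∀ z ∈ Q, ∀ κ : Fin d, z + e κ ∈ cube L c.a c.M c.ρ c.k c.k := fun z hz κ => add_e_mem_cube_top hL1 hρ (hQ hz) κ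
  have hside : ∀ z ∈ Q, ∀ ν : Fin d, SideTouches (c.sq c.k) z ν := fun z hz ν => hsideOf z (hmemk z hz) ν
  have hside' : ∀ z ∈ Q, ∀ κ ν : Fin d, SideTouches (c.sq c.k) (z + e κ) ν := fun z hz κ ν => hsideOf _ (hmemk' z hz κ) ν
  have htil : ∀ z ∈ Q, InBox (tlo L (tLo c.a c.ρ) c.k) (thi L (tHi c.a c.M c.ρ) c.k) z := fun z hz =>
    cube_subset_tcube hL hρ le_rfl (hmemk z hz)
  have htil' : ∀ z ∈ Q, ∀ κ : Fin d, InBox (tlo L (tLo c.a c.ρ) c.k) (thi L (tHi c.a c.M c.ρ) c.k) (z + e κ) := fun z hz κ =>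
    cube_subset_tcube hL hρ le_rfl (hmemk' z hz κ)
  -- scale letters
  have hξ : scaleLen (L : ℝ) η c.k = (L : ℝ) ^ c.k * η := rfl
  have hspos : 0 < (L : ℝ) ^ c.k * η := by positivity
  have hnη : ‖((η : ℂ)⁻¹)‖ = η⁻¹ := by
    rw [norm_inv, Complex.norm_real, Real.norm_eq_abs, abs_of_pos hη]
  -- (1.136)₁ in the shape read by the masked-family lemmas
  have h136₁ : ∀ j, j ≤ c.k → ∀ b ∈ {b : B7Prop1Explicit.Site d × Fin d | SideTouches (c.sq j) b.1 b.2},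
      ‖logCfg η (c.fixed U₀ u) b.1 b.2‖ ≤ r * ((L : ℝ) ^ j * η)⁻¹ := fun j hj b hb => (h162 j hj b hb).2.2
  -- the gauge `(v⁻¹u′)⁻¹` and the field `A = (1/iη) log U₁`
  refine ⟨fun x => (((c.vfix U₀)⁻¹ * u) x)⁻¹, byDir (logCfg η (c.fixed U₀ u)), ?_, ?_, ?_, ?_, ?_⟩
  · -- unit type
    intro z _
    have h1 : (((c.vfix U₀)⁻¹ * u) z)⁻¹ ∈ U1 𝔸 := unitaryUnits_le_U1 ((unitaryUnits 𝔸).inv_mem (hw z))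
    exact ⟨h1.1, h1.2⟩
  · -- `U₀^u = e^{iηA}` on the bonds of `Q`
    intro κ z hz
    have hag : gaugeAct (fun x => (((c.vfix U₀)⁻¹ * u) x)⁻¹) U₀ z κ = c.fixed U₀ u z κ := h135 z κ (htil z hz) (htil' z hz κ)
    have hexp := (h162 c.k le_rfl ⟨z, κ⟩ (hside z hz κ)).1
    rw [gaugeTr_byDir, byDir_apply, hag, hexp]
    ext
    simp only [fluct, byDir_apply, B9Eq37Insertion.val_holU, Beta.TransportVertices.holonomy_cons, Beta.TransportVertices.holonomy_nil, mul_one,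
      cfgExp, val_expUnit]
    rw [← smul_smul, Complex.coe_smul]
  · -- `|A| < C(Lᵏη)⁻¹`
    intro κ z hz
    have hb := (h162 c.k le_rfl ⟨z, κ⟩ (hside z hz κ)).2.2
    rw [hξ, byDir_apply]
    calc ‖logCfg η (c.fixed U₀ u) z κ‖ ≤ r * ((L : ℝ) ^ c.k * η)⁻¹ := hb
      _ < C * ((L : ℝ) ^ c.k * η)⁻¹ := mul_lt_mul_of_pos_right hrC (inv_pos.mpr hspos)
  · -- `|∇^ηA| < C(Lᵏη)⁻²`: the `j = k` member of the `msup (−2)` clause, read pointwise on a bounded family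
    intro κ ν z hz
    have hB := bdd_sideTouches_cubeFam L c.a c.M c.ρ c.k η (-(2 : ℝ))
      (fun t : Fin d × Fin d × B7Prop1Explicit.Site d => covDerivFwd η (1 : B7Prop1Explicit.Site d → Fin d → 𝔸ˣ) t.1 (fun w => c.expo η U₀ u w t.2.1) t.2.2)
    have hpt := norm_le_of_msup_le hL1 hη hB h136₂ (j := c.k) le_rfl (i := (κ, ν, z)) (hside z hz ν)
    have he1 : c.expo η U₀ u z ν = logCfg η (c.fixed U₀ u) z ν := mlogCfg_of_sideTouches η _ le_rfl (hside z hz ν)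
    have he2 : c.expo η U₀ u (z + e κ) ν = logCfg η (c.fixed U₀ u) (z + e κ) ν := mlogCfg_of_sideTouches η _ le_rfl (hside' z hz κ ν)
    have hcd : covDerivFwd η (1 : B7Prop1Explicit.Site d → Fin d → 𝔸ˣ) κ (fun w => c.expo η U₀ u w ν) z =
        η⁻¹ • (logCfg η (c.fixed U₀ u) (z + e κ) ν - logCfg η (c.fixed U₀ u) z ν) := by
      simp only [covDerivFwd, he1, he2, Pi.one_apply, conjR, Units.val_one, inv_one, one_mul, mul_one]
    have hcov : covD (shiftT d) (fun _ _ => (1 : 𝔸ˣ)) κ (byDir (logCfg η (c.fixed U₀ u)) ν) z =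
        logCfg η (c.fixed U₀ u) (z + e κ) ν - logCfg η (c.fixed U₀ u) z ν := by
      simp only [covD, R, byDir_apply, shiftT_apply, Units.val_one, inv_one, one_mul, mul_one]
    have hrpow : ((L : ℝ) ^ c.k * η) ^ (-(2 : ℝ)) = (((L : ℝ) ^ c.k * η) ^ 2)⁻¹ := by
      rw [Real.rpow_neg hspos.le, Real.rpow_two]
    have h1 : η⁻¹ * ‖logCfg η (c.fixed U₀ u) (z + e κ) ν - logCfg η (c.fixed U₀ u) z ν‖ ≤ r * (((L : ℝ) ^ c.k * η) ^ 2)⁻¹ := by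
      have h2 := hpt
      rw [hcd, norm_smul, Real.norm_eq_abs, abs_inv, abs_of_pos hη, hrpow] at h2
      exact h2
    rw [hcov, norm_smul, hnη, hξ]
    calc η⁻¹ * ‖logCfg η (c.fixed U₀ u) (z + e κ) ν - logCfg η (c.fixed U₀ u) z ν‖ ≤ r * (((L : ℝ) ^ c.k * η) ^ 2)⁻¹ := h1
      _ < C * (((L : ℝ) ^ c.k * η) ^ 2)⁻¹ := mul_lt_mul_of_pos_right hrC (inv_pos.mpr (by positivity))
  · -- `|∂^{η*}∂^ηA| < C(Lᵏη)⁻³`: the (1.136)₃ member read pointwise on `□`, unmasked on the stencil inside `□_k`, in r06's letters by §1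
    intro μ z hz
    have hx : z ∈ box L c.a c.M c.k := hQ hz
    -- masked bound at the bond `⟨z, z + e_μ⟩`
    have hmask := norm_codiff_mlogCfg_le c hL1 hη hr (c.fixed U₀ u) h136₁ h136₃ hx μ
    -- unmasking on the stencil
    have hst := fun ν => stencil_mem_cube_top hL1 hρ hx μ ν
    have hun : ∀ y, y ∈ cube L c.a c.M c.ρ c.k c.k → ∀ κ, mlogCfg c.k η c.sq (c.fixed U₀ u) y κ = logCfg η (c.fixed U₀ u) y κ :=
      fun y hy κ => mlogCfg_of_sideTouches η _ le_rfl (hsideOf y hy κ)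
    have heq := pdiv_plaqCovDeriv_one_congr η (A := mlogCfg c.k η c.sq (c.fixed U₀ u)) (A' := logCfg η (c.fixed U₀ u)) (x := z) (μ := μ)
      (fun κ => hun z (hst μ).1 κ) (fun κ => hun _ (hst μ).2.1 κ)
      (fun ν κ => ⟨hun _ (stencil_mem_cube_top hL1 hρ hx ν ν).2.1 κ, hun _ (hst ν).2.2.1 κ, hun _ (hst ν).2.2.2 κ⟩)
    rw [divPη_curlη_one_eq_pdiv_plaqCovDeriv, ← heq, hξ]
    calc ‖pdiv η (1 : B7Prop1Explicit.Site d → Fin d → 𝔸ˣ) (plaqCovDeriv η 1 (mlogCfg c.k η c.sq (c.fixed U₀ u))) μ z‖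
        ≤ r * (((L : ℝ) ^ c.k * η) ^ 3)⁻¹ := hmask
      _ < C * (((L : ℝ) ^ c.k * η) ^ 3)⁻¹ := mul_lt_mul_of_pos_right hrC (inv_pos.mpr (by positivity))

/-- (3.36) on a cube includes (3.35) on it — so the bridge also serves r06's `Reg335Cube` (n05-e's `reg335Cube_of_gaugedBoundB8`, for `0 ≤ r`).
[cite: Balaban1985BackgroundPropagators, (3.35)–(3.36) p.396] -/
theorem reg335Cube_of_gaugedBoundB8' (hd2 : 2 ≤ d) {L K : ℕ} (hL : 2 ≤ L) {Ω : ℕ → Set (B7Prop1Explicit.Site d)} {η : ℝ} (hη : 0 < η)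
    {U₀ : B7Prop1Explicit.Site d → Fin d → 𝔸ˣ} (c : CubeB8 d L K Ω) {r C : ℝ} (hr : 0 ≤ r) (hrC : r < C)
    (h : GaugedBoundB8 L η U₀ c r) {Q : Set (B7Prop1Explicit.Site d)} (hQ : Q ⊆ box L c.a c.M c.k) :
    Reg335Cube (shiftT d) (byDir U₀) η Q (scaleLen (L : ℝ) η c.k) C :=
  (reg336Cube_of_gaugedBoundB8 hd2 hL hη c hr hrC h hQ).reg335Cube _ _

end Bridge

/-! ## §3 (3.35)–(3.36) on ONE class cube of index `k ≥ 1` of the all-torus `ℤᵈ` member, from Proposition 6 AS PRINTED (unconditional) -/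

section OneCube

variable {𝔸 : Type} [CStarAlgebra 𝔸] [Nontrivial 𝔸]

/-- ★★ **[4] (3.35)–(3.36) ON A CLASS CUBE OF THE ALL-TORUS MEMBER, FROM [B8] PROPOSITION 6** (`d ≥ 2`, `L ≥ 5` odd, any nontrivial C⋆-algebra `𝔸`): there are
`c35, c₆ > 0` (`c35 = 7dL³B₁ρ₀(11d + 21) + 1`, `c₆ = c₁ ∕ (7dL³ρ₀(11d + 21))`, `B₁ = 5dLB₀`, with `ρ₀, B₀, c₁` the constants of
`B8Prop6PrintedZdCubPGamma.prop6Printed_zdCubP_γ_holds`) such that for every spacing `η > 0`, index `k ≥ 1`, block parameter `M ≥ 1`, every p. 396 class cube `Q` of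
index `k` (`IsCube396Zd M L k Q`: side `n·⌈M⌉₊·Lᵏ`, `n ≤ 10`, corner on the grid), every unitary `U₀ ∈ 𝔄_k(ℤᵈ, α₀)` (`InAk L k η α₀ (Ω ≡ ℤᵈ) U₀`) with `M·α₀ ≤ c₆`, and
every constant `C ≥ c35`: `Reg336Cube (shiftT d) (byDir U₀) η Q (Lᵏη) (C·M·α₀)`.  Proof = n05-e's `prop6At_bgZd_allTorus_of_prop6Printed` at ONE cube of index `k = m ≥ 1`
(inscription into a print cube of the auxiliary all-torus datum `torusIdx ⟨η, k⟩`, Proposition 6 there, §2), no index-0 case.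
[cite: Balaban1985RegularSpaces, Prop. 6 (1.135)–(1.138) p.99, (1.33) p.82, p.98; Balaban1985BackgroundPropagators, (3.35)–(3.36) p.396] -/
theorem reg336Cube_zd_of_inAk (hd2 : 2 ≤ d) {L : ℕ} (hL5 : 5 ≤ L) (hodd : Odd L) :
    ∃ c35 c₆ : ℝ, 0 < c35 ∧ 0 < c₆ ∧
      ∀ (η : ℝ) (_ : 0 < η) (k : ℕ) (_ : 1 ≤ k) (M : ℝ) (_ : 1 ≤ M) (Q : Set (B7Prop1Explicit.Site d)) (_ : IsCube396Zd M L k Q)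
        (U₀ : B7Prop1Explicit.Site d → Fin d → 𝔸ˣ) (_ : ∀ x κ, U₀ x κ ∈ unitaryUnits 𝔸) (α₀ : ℝ) (_ : 0 < α₀) (_ : M * α₀ ≤ c₆)
        (_ : InAk L k η α₀ (fun _ : ℕ => (Set.univ : Set (B7Prop1Explicit.Site d))) U₀) (C : ℝ) (_ : c35 ≤ C),
        Reg336Cube (shiftT d) (byDir U₀) η Q (scaleLen (L : ℝ) η k) (C * M * α₀) := by
  obtain ⟨ρ₀, B₀, c₁, hρ₀, hB₀, hc₁, H⟩ := prop6Printed_zdCubP_γ_holds (𝔸 := 𝔸) hd2 hL5 hodd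
  -- letters and positivity
  have hd1 : 1 ≤ d := le_trans one_le_two hd2
  have hL : 2 ≤ L := le_trans (by norm_num) hL5
  have hL1 : 1 ≤ L := le_trans one_le_two hL
  have hdR : (1 : ℝ) ≤ d := by exact_mod_cast hd1
  have hLR : (2 : ℝ) ≤ L := by exact_mod_cast hL
  have hρR : (1 : ℝ) ≤ ρ₀ := by exact_mod_cast hρ₀
  have hd0 : (0 : ℝ) < d := by linarith
  have hL0 : (0 : ℝ) < L := by linarith
  have hρ0 : (0 : ℝ) < ρ₀ := by linarith
  have hB₀0 : (0 : ℝ) ≤ B₀ := le_trans zero_le_one hB₀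
  set B₁ : ℝ := 5 * d * L * B₀ with hB₁
  have hB₁0 : 0 ≤ B₁ := by positivity
  refine ⟨7 * d * (L : ℝ) ^ 3 * B₁ * ρ₀ * (11 * d + 21) + 1, c₁ / (7 * d * (L : ℝ) ^ 3 * ρ₀ * (11 * d + 21)), by positivity, by positivity, ?_⟩
  intro η hη k hk M hM Q hQ U₀ hU₀ α₀ hα₀ hMα hIn C hC
  have hM0 : 0 ≤ M := le_trans zero_le_one hM
  have hceil : (⌈M⌉₊ : ℝ) ≤ 2 * M := by
    have := Nat.ceil_lt_add_one hM0
    linarith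
  -- inscription into a print cube of the all-torus datum `torusIdx ⟨η, k⟩` (truncation `m = k`)
  obtain ⟨c, hcP, hck, hQc, hcM⟩ := exists_printCube_over_classCube hd1 hL1 hρ₀ (j := k) (m := k) hk le_rfl hQ
  -- Proposition 6 at the cube (threshold from `Mα₀ ≤ c₆`)
  have hP := (prop6Printed_zdCubP_iff (𝔸 := 𝔸) (fun _ : Unit => torusIdx (d := d) hL1 ⟨η, hη, k, hk⟩) ρ₀ B₁ c₁).1 (H _) () α₀ hα₀ ⟨U₀, hU₀⟩ hIn c hcP
  have hcMR : (c.M : ℝ) ≤ ρ₀ * L * (11 * d + 21) * M := by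
    have h1 : (c.M : ℝ) ≤ ρ₀ * L * (10 * ⌈M⌉₊ + 11 * d + 1) := by exact_mod_cast hcM
    have h2 : (10 * ⌈M⌉₊ + 11 * d + 1 : ℝ) ≤ (11 * d + 21) * M := by
      nlinarith [mul_nonneg (sub_nonneg.2 hdR) (sub_nonneg.2 hM), hceil]
    have h3 : (ρ₀ : ℝ) * L * (10 * ⌈M⌉₊ + 11 * d + 1) ≤ ρ₀ * L * ((11 * d + 21) * M) := mul_le_mul_of_nonneg_left h2 (by positivity)
    linarith
  have hthr : 7 * d * (L : ℝ) ^ 2 * c.M * α₀ ≤ c₁ := by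
    have h1 : 7 * d * (L : ℝ) ^ 2 * c.M * α₀ ≤ 7 * d * (L : ℝ) ^ 2 * (ρ₀ * L * (11 * d + 21) * M) * α₀ := by
      apply mul_le_mul_of_nonneg_right _ hα₀.le
      exact mul_le_mul_of_nonneg_left hcMR (by positivity)
    have h2 : 7 * d * (L : ℝ) ^ 2 * (ρ₀ * L * (11 * d + 21) * M) * α₀ = 7 * d * (L : ℝ) ^ 3 * ρ₀ * (11 * d + 21) * (M * α₀) := by ring
    have hpos : 0 < 7 * d * (L : ℝ) ^ 3 * ρ₀ * (11 * d + 21) := by positivity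
    have h3 : 7 * d * (L : ℝ) ^ 3 * ρ₀ * (11 * d + 21) * (M * α₀) ≤ c₁ :=
      calc 7 * d * (L : ℝ) ^ 3 * ρ₀ * (11 * d + 21) * (M * α₀)
          ≤ 7 * d * (L : ℝ) ^ 3 * ρ₀ * (11 * d + 21) * (c₁ / (7 * d * (L : ℝ) ^ 3 * ρ₀ * (11 * d + 21))) :=
            mul_le_mul_of_nonneg_left hMα hpos.le
        _ = c₁ := by field_simp
    linarith
  have hG : GaugedBoundB8 L η U₀ c (7 * d * (L : ℝ) ^ 2 * B₁ * c.M * α₀) := hP hthr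
  -- the bridge §2, with `0 ≤ r = 7dL²B₁·c.M·α₀ < C·M·α₀`
  have hr : 0 ≤ 7 * d * (L : ℝ) ^ 2 * B₁ * c.M * α₀ := by positivity
  have hrC : 7 * d * (L : ℝ) ^ 2 * B₁ * c.M * α₀ < C * M * α₀ := by
    have h1 : 7 * d * (L : ℝ) ^ 2 * B₁ * c.M * α₀ ≤ 7 * d * (L : ℝ) ^ 3 * B₁ * ρ₀ * (11 * d + 21) * M * α₀ := by
      have : 7 * d * (L : ℝ) ^ 2 * B₁ * c.M * α₀ ≤ 7 * d * (L : ℝ) ^ 2 * B₁ * (ρ₀ * L * (11 * d + 21) * M) * α₀ := by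
        apply mul_le_mul_of_nonneg_right _ hα₀.le
        exact mul_le_mul_of_nonneg_left hcMR (by positivity)
      linarith [this]
    have hMα0 : 0 < M * α₀ := mul_pos (lt_of_lt_of_le one_pos hM) hα₀
    have h2 : (7 * d * (L : ℝ) ^ 3 * B₁ * ρ₀ * (11 * d + 21) + 1) * (M * α₀) ≤ C * (M * α₀) := mul_le_mul_of_nonneg_right hC hMα0.le
    nlinarith
  have hres := reg336Cube_of_gaugedBoundB8 hd2 hL hη c hr hrC hG hQc
  rw [hck] at hres
  exact hres

end OneCube

end Summit.QuantumFields.YangMills.Theorems.Prop7SectET3ClassTransferZd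

end
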